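import Literature.Topology.FourManifolds.KhFaces
import Literature.Topology.FourManifolds.KhFlipReach
import Literature.Topology.FourManifolds.KhComplexQDegreeProofs
import Literature.Topology.FourManifolds.KhComplexFaceProofs
import Literature.Topology.FourManifolds.LeeRasmussenProofs
import Literature.Topology.FourManifolds.LeeRasmussenBasisProofs
import Literature.Topology.FourManifolds.LeeRasmussenFaceProofs
import HarnessLib

/-!
# Lee's differential is label-preserving in Lee's coordinates

Sibling file of `LeeRasmussen.lean` on the way to Lee's theorem `finrank_leeHomologyZero_eq_two`
(Lee (2005), Thm. 4.2): the computation behind Lee's observation that in the basis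
`𝐚 = X + 𝟙`, `𝐛 = X - 𝟙` the maps of the Khovanov complex at `(h, t) = (0, 1)` are
`m(𝐚,𝐚) = 2𝐚`, `m(𝐛,𝐛) = -2𝐛`, `m(𝐚,𝐛) = 0`, `Δ𝐚 = 𝐚 ⊗ 𝐚`, `Δ𝐛 = 𝐛 ⊗ 𝐛` (Lee (2005), §4;
Rasmussen (2010), §2.1, (3)), transcribed to the enhanced-state model of `KhComplex`:

* `leeDiffMat k k'` — the **label-preserving Lee matrix**: its entry at (`(σ[i ↦ 1], ℓ)`,
  `(σ, ℓ)`) is `edgeSign σ i · leeCoef σ i ℓ` (`leeCoef`: `±1` at a merge, `2` at a split,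
  `LeeRasmussenFaceProofs`), all other entries vanish;
* `leeBasisMat_transpose_mul_incidence` — **the intertwining identity**
  `Mᵀ · Inc = leeDiffMat · Mᵀ` between the incidence matrix `Inc(s', s) = ⟨d s, s'⟩` of Lee's
  differential `leeD = khovanovD ℚ 0 1` and the transpose of Lee's change-of-basis matrix
  (`leeBasisMat`, `LeeRasmussenBasisProofs`); as linear maps (`Matrix.toLin'_mul`),
  `leeCoord k' ∘ leeD k k' = toLin' (leeDiffMat k k') ∘ leeCoord k` (`leeCoord_comp_leeD`).

The entry of `Mᵀ · Inc` at (`(σ', ℓ)`, `(σ, λ)`) is a sum over the enhanced states `(σ', μ)`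
incident to `(σ, λ)`; these sums are collapsed to sums over the labels of the one or two new
circles by the abstract lemmas `KhFace.sum_mergeInc_mul` / `KhFace.sum_splitInc_mul` of
`KhFaces` (the surgery relations `KhFace.Surg` are `IsMergeAt.surg` / `IsSplitAt.surg` of
`KhComplexFaceProofs`), the signs `(-1)^{pairCount}` are compared across
the surgery by the counting lemma `card_filter_circle_surgery` of `KhComplexQDegreeProofs`, and
what remains are identities of the `2 × 2 × 2` tables of `A = ℚ[X]/(X² - 1)`.

## References

* E. S. Lee, *An endomorphism of the Khovanov invariant*, Adv. Math. 197 (2005) 554–586, §4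
  (the maps in the basis `𝐚`, `𝐛`), §4.4.2 (the adjoint). [cite: Lee2005, §4]
* J. Rasmussen, *Khovanov homology and the slice genus*, Invent. Math. 182 (2010), §2.1,
  display (3). [cite: Rasmussen2010, §2.1]
* O. Viro, Fund. Math. 184 (2004), §5.2 (incidence numbers). [cite: Viro2004, §5.2]
-/

open Function Set Matrix

noncomputable section

namespace Literature.Topology.FourManifolds

namespace GaussDiagram

variable {G : GaussDiagram}

/-- Being a labelling of a state is decidable (finitely many adjacency conditions). [folklore] -/
instance instDecidableIsLabelOf (σ : G.State) (ℓ : G.Arc → Bool) : Decidable (G.IsLabelOf σ ℓ) := by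
  unfold IsLabelOf; infer_instance

/-! ## Labellings in the abstract form of `KhFaces` -/

/-- A labelling in the sense of `KhFace.Lab (circleOf σ)` is a labelling of `σ`. [folklore] -/
theorem isLabelOf_of_lab {σ : G.State} (mu : KhFace.Lab (G.circleOf σ)) : G.IsLabelOf σ mu.1 :=
  fun a b hab ↦ mu.2 a b (SimpleGraph.ConnectedComponent.sound hab.reachable)

/-- A labelling of `σ` is a labelling in the sense of `KhFace.Lab (circleOf σ)`. [folklore] -/
theorem lab_of_isLabelOf {σ : G.State} {f : G.Arc → Bool} (hf : G.IsLabelOf σ f) :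
    ∀ x y, G.circleOf σ x = G.circleOf σ y → f x = f y :=
  fun _ _ hxy ↦ hf.eq_of_reachable (circleOf_eq_iff.1 hxy)

/-- The enhanced states of degree `k` over a fixed state `τ` of that degree are the labellings
`KhFace.Lab (circleOf τ)`. [folklore] -/
def stateFibreLabEquiv (k : ℤ) (τ : G.State) (hk : (τ.weight : ℤ) - G.nMinus = k) :
    {s : G.degStates k // s.1.state = τ} ≃ KhFace.Lab (G.circleOf τ) where
  toFun s := ⟨s.1.1.label, lab_of_isLabelOf (isLabelOf_of_state_eq s.2)⟩
  invFun mu := ⟨⟨⟨τ, mu.1, isLabelOf_of_lab mu⟩, by rw [homDegree]; exact hk⟩, rfl⟩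
  left_inv := by
    rintro ⟨⟨s, hs⟩, hτ⟩
    simp only at hτ
    subst hτ
    rfl
  right_inv mu := rfl

/-! ## Signs of pairs of labellings across a surgery -/

/-- The Boolean combination `¬λ ∧ ℓ` of two labellings of a state is a labelling. [folklore] -/
theorem isLabelOf_pair {σ : G.State} {lam ell : G.Arc → Bool} (hl : G.IsLabelOf σ lam)
    (he : G.IsLabelOf σ ell) : G.IsLabelOf σ (fun a ↦ !lam a && ell a) := fun a b hab ↦ by
  simp only [hl a b hab, he a b hab]

/-- The enhanced state recording on each circle whether `λ = 𝟙` and `ℓ = 𝐛` there (so that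
`pairCount σ λ ℓ` counts its circles labelled `true`). Auxiliary. [folklore] -/
def pairEnhanced (σ : G.State) (lam ell : G.Arc → Bool) (hl : G.IsLabelOf σ lam)
    (he : G.IsLabelOf σ ell) : G.EnhancedState :=
  ⟨σ, fun a ↦ !lam a && ell a, isLabelOf_pair hl he⟩

/-- `pairCount` is the number of circles labelled `true` of `pairEnhanced`. [folklore] -/
theorem pairCount_eq_card (σ : G.State) (lam ell : G.Arc → Bool) (hl : G.IsLabelOf σ lam)
    (he : G.IsLabelOf σ ell) :
    G.pairCount σ lam ell = (Finset.univ.filter fun c : G.StateCircle (G.pairEnhanced σ lam ell hl he).state ↦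
      ∃ a, G.circleOf (G.pairEnhanced σ lam ell hl he).state a = c ∧
        (G.pairEnhanced σ lam ell hl he).label a = true).card := rfl

/-- `(-1)^[(¬x) ∧ t]` is the one-circle sign `pairSign x t`. [folklore] -/
theorem neg_one_pow_ite_eq_pairSign (x t : Bool) :
    (-1 : ℚ) ^ (if (!x && t) = true then 1 else 0) = pairSign x t := by
  unfold pairSign
  split_ifs <;> simp

/-- `pairSign x t` is `±1`. [folklore] -/
theorem pairSign_mul_self (x t : Bool) : pairSign x t * pairSign x t = 1 := by
  cases x <;> cases t <;> norm_num [pairSign]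

/-- Parity bookkeeping: from `N + a = N' + b + c` in `ℕ`,
`(-1)^{N'} = (-1)^N (-1)^a (-1)^b (-1)^c`. [folklore] -/
theorem neg_one_pow_eq_of_add_eq {N a N' b c : ℕ} (h : N + a = N' + b + c) :
    (-1 : ℚ) ^ N' = (-1) ^ N * (-1) ^ a * (-1) ^ b * (-1) ^ c := by
  rw [← pow_add, ← pow_add, ← pow_add, neg_one_pow_eq_pow_mod_two (R := ℚ),
    neg_one_pow_eq_pow_mod_two (R := ℚ) (n := N + a + b + c)]
  congr 1
  omega

/-- Parity bookkeeping, the other way round: from `N + a = N' + b + c` in `ℕ`,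
`(-1)^N = (-1)^{N'} (-1)^a (-1)^b (-1)^c`. [folklore] -/
theorem neg_one_pow_eq_of_add_eq' {N a N' b c : ℕ} (h : N + a = N' + b + c) :
    (-1 : ℚ) ^ N = (-1) ^ N' * (-1) ^ a * (-1) ^ b * (-1) ^ c := by
  rw [← pow_add, ← pow_add, ← pow_add, neg_one_pow_eq_pow_mod_two (R := ℚ),
    neg_one_pow_eq_pow_mod_two (R := ℚ) (n := N' + a + b + c)]
  congr 1
  omega

/-- **Signs across a merge.** For a merge at `i` in `σ` (new state `σ'`), a labelling `λ` of `σ`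
and a labelling `ℓ` of `σ'` (with common value `t` on the merged circle), putting `v` on the
merged circle: `(-1)^{pairCount σ' λ[C* ↦ v] ℓ} = (-1)^{pairCount σ λ ℓ} · s(v, ℓ A) s(λ A, ℓ A) s(λ B, ℓ B)`
(all circles other than the merged ones are common to `σ` and `σ'`:
`card_filter_circle_surgery`). [folklore] -/
theorem neg_one_pow_pairCount_merge {σ : G.State} {i : Fin G.n} (hM : G.IsMergeAt σ i)
    {lam ell : G.Arc → Bool} (hl : G.IsLabelOf σ lam)
    (he : G.IsLabelOf (Function.update σ i true) ell) (v : Bool) :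
    (-1 : ℚ) ^ G.pairCount (Function.update σ i true)
        (KhFace.upd (G.circleOf (Function.update σ i true)) lam (G.arcIn (G.overPos i)) v) ell =
      (-1 : ℚ) ^ G.pairCount σ lam ell * pairSign v (ell (G.arcIn (G.overPos i))) *
        pairSign (lam (G.arcIn (G.overPos i))) (ell (G.arcIn (G.overPos i))) *
        pairSign (lam (G.arcOut (G.overPos i))) (ell (G.arcOut (G.overPos i))) := by
  have S := hM.surg
  have he₀ : G.IsLabelOf σ ell := fun a b hab ↦
    he.eq_of_reachable (hM.reachable_update_of_reachable hab.reachable)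
  have hupd : G.IsLabelOf (Function.update σ i true)
      (KhFace.upd (G.circleOf (Function.update σ i true)) lam (G.arcIn (G.overPos i)) v) :=
    isLabelOf_of_lab ⟨_, KhFace.upd_mem_lab S ⟨lam, lab_of_isLabelOf hl⟩ v⟩
  have heq : G.circleOf (Function.update σ i true) (G.arcIn (G.overPos i)) =
      G.circleOf (Function.update σ i true) (G.arcOut (G.overPos i)) := by
    by_contra hne
    exact IsMergeAt.not_isSplitAt_holds hM ⟨hM.1, hne⟩
  have key := card_filter_circle_surgery (s₁ := G.pairEnhanced σ lam ell hl he₀)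
    (s₂ := G.pairEnhanced _ _ ell hupd he) (i := i)
    (fun j hj ↦ Function.update_of_ne hj _ _) hM.2 heq (fun x hx ↦ by
      change G.circleOf (Function.update σ i true) x ≠ _ at hx
      change (!(KhFace.upd _ lam _ v x) && ell x) = (!lam x && ell x)
      rw [KhFace.upd_of_ne hx]) true
  rw [← pairCount_eq_card, ← pairCount_eq_card] at key
  simp only [pairEnhanced, KhFace.upd_self] at key
  unfold pairSign
  split_ifs at key ⊢ <;> (rw [neg_one_pow_eq_of_add_eq key]; ring)

/-- **Signs across a split.** For a split at `i` in `σ` (new state `σ'`), labellings `λ`, `ℓ` of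
`σ` (`t = ℓ A = ℓ B`), putting `v`, `w` on the two new circles:
`(-1)^{pairCount σ' λ[A ↦ v, B ↦ w] ℓ} = (-1)^{pairCount σ λ ℓ} · s(λ A, ℓ A) s(v, ℓ A) s(w, ℓ B)`.
[folklore] -/
theorem neg_one_pow_pairCount_split {σ : G.State} {i : Fin G.n} (hS : G.IsSplitAt σ i)
    {lam ell : G.Arc → Bool} (hl : G.IsLabelOf σ lam) (he : G.IsLabelOf σ ell) (v w : Bool) :
    (-1 : ℚ) ^ G.pairCount (Function.update σ i true)
        (KhFace.upd (G.circleOf (Function.update σ i true))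
          (KhFace.upd (G.circleOf (Function.update σ i true)) lam (G.arcOut (G.overPos i)) w)
          (G.arcIn (G.overPos i)) v) ell =
      (-1 : ℚ) ^ G.pairCount σ lam ell *
        pairSign (lam (G.arcIn (G.overPos i))) (ell (G.arcIn (G.overPos i))) *
        pairSign v (ell (G.arcIn (G.overPos i))) * pairSign w (ell (G.arcOut (G.overPos i))) := by
  have S := hS.surg
  have he' : G.IsLabelOf (Function.update σ i true) ell := fun a b hab ↦
    he.eq_of_reachable (hS.reachable_of_reachable_update hab.reachable)
  have hupd : G.IsLabelOf (Function.update σ i true)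
      (KhFace.upd (G.circleOf (Function.update σ i true))
        (KhFace.upd (G.circleOf (Function.update σ i true)) lam (G.arcOut (G.overPos i)) w)
        (G.arcIn (G.overPos i)) v) :=
    isLabelOf_of_lab ⟨_, KhFace.upd_upd_mem_lab S ⟨lam, lab_of_isLabelOf hl⟩ v w⟩
  have hM : ¬ G.IsMergeAt σ i := fun hM ↦ IsMergeAt.not_isSplitAt_holds hM hS
  have heq : G.circleOf σ (G.arcIn (G.overPos i)) = G.circleOf σ (G.arcOut (G.overPos i)) := by
    by_contra hne
    exact hM ⟨hS.1, hne⟩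
  have hba : G.circleOf (Function.update σ i true) (G.arcOut (G.overPos i)) ≠
      G.circleOf (Function.update σ i true) (G.arcIn (G.overPos i)) := fun h' ↦ S.ne h'.symm
  have key := card_filter_circle_surgery (s₁ := G.pairEnhanced _ _ ell hupd he')
    (s₂ := G.pairEnhanced σ lam ell hl he) (i := i)
    (fun j hj ↦ (Function.update_of_ne hj _ _).symm) hS.2 heq (fun x hx ↦ by
      change G.circleOf σ x ≠ _ at hx
      have hxa : G.circleOf (Function.update σ i true) x ≠
          G.circleOf (Function.update σ i true) (G.arcIn (G.overPos i)) := fun h' ↦ hx (S.le h')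
      have hxb : G.circleOf (Function.update σ i true) x ≠
          G.circleOf (Function.update σ i true) (G.arcOut (G.overPos i)) :=
        fun h' ↦ hx ((S.le h').trans S.eq.symm)
      change (!lam x && ell x) = (!(KhFace.upd _ (KhFace.upd _ lam _ w) _ v x) && ell x)
      rw [KhFace.upd_of_ne hxa, KhFace.upd_of_ne hxb]) true
  rw [← pairCount_eq_card, ← pairCount_eq_card] at key
  simp only [pairEnhanced, KhFace.upd_self, KhFace.upd_of_ne hba] at key
  unfold pairSign
  split_ifs at key ⊢ <;> (rw [neg_one_pow_eq_of_add_eq' key]; ring)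

/-- Updating a labelling on one class of a circle map gives a labelling (same circle map).
[folklore] -/
theorem upd_congr {Y : Type*} [DecidableEq Y] {c : G.Arc → Y} {f : G.Arc → Bool} {a : G.Arc}
    {v : Bool} (hf : ∀ x y, c x = c y → f x = f y) :
    ∀ x y, c x = c y → KhFace.upd c f a v x = KhFace.upd c f a v y := by
  intro x y hxy
  unfold KhFace.upd
  rw [hxy, hf x y hxy]

/-- The defining predicate of `pairCount` on the circle of `a`, for labellings. [folklore] -/
theorem exists_circleOf_pair_iff {τ : G.State} {f ell : G.Arc → Bool} (hf : G.IsLabelOf τ f)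
    (he : G.IsLabelOf τ ell) (a : G.Arc) :
    (∃ x, G.circleOf τ x = G.circleOf τ a ∧ (!f x && ell x) = true) ↔ (!f a && ell a) = true := by
  constructor
  · rintro ⟨x, hx, h⟩
    rw [hf.eq_of_reachable (circleOf_eq_iff.1 hx.symm), he.eq_of_reachable (circleOf_eq_iff.1 hx.symm)]
    exact h
  · exact fun h ↦ ⟨a, rfl, h⟩

/-- **Signs of a relabelling on two circles of one state.** For circles `C_A ≠ C_B` of `τ` and
labellings `f`, `ℓ` of `τ`, putting `v` on `C_A` and `w` on `C_B`:
`(-1)^{pairCount τ f[A ↦ v, B ↦ w] ℓ} · s(f A, ℓ A) s(f B, ℓ B) = (-1)^{pairCount τ f ℓ} · s(v, ℓ A) s(w, ℓ B)`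
(the other circles contribute equally). [folklore] -/
theorem neg_one_pow_pairCount_upd_upd {τ : G.State} {A B : G.Arc}
    (hAB : G.circleOf τ A ≠ G.circleOf τ B) {f ell : G.Arc → Bool} (hf : G.IsLabelOf τ f)
    (he : G.IsLabelOf τ ell) (v w : Bool) :
    (-1 : ℚ) ^ G.pairCount τ (KhFace.upd (G.circleOf τ) (KhFace.upd (G.circleOf τ) f B w) A v) ell *
        pairSign (f A) (ell A) * pairSign (f B) (ell B) =
      (-1 : ℚ) ^ G.pairCount τ f ell * pairSign v (ell A) * pairSign w (ell B) := by
  classical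
  have hBA : G.circleOf τ B ≠ G.circleOf τ A := fun h' ↦ hAB h'.symm
  have hgA : KhFace.upd (G.circleOf τ) (KhFace.upd (G.circleOf τ) f B w) A v A = v := KhFace.upd_self
  have hgB : KhFace.upd (G.circleOf τ) (KhFace.upd (G.circleOf τ) f B w) A v B = w := by
    rw [KhFace.upd_of_ne hBA, KhFace.upd_self]
  have hgc : G.IsLabelOf τ (KhFace.upd (G.circleOf τ) (KhFace.upd (G.circleOf τ) f B w) A v) :=
    isLabelOf_of_lab ⟨_, upd_congr (upd_congr (lab_of_isLabelOf hf))⟩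
  -- splitting off the two circles `C_A`, `C_B` from the count
  have hcount : ∀ (h : G.Arc → Bool), G.IsLabelOf τ h →
      G.pairCount τ h ell =
        ((Finset.univ.filter fun C : G.StateCircle τ ↦
            ∃ x, G.circleOf τ x = C ∧ (!h x && ell x) = true) \ {G.circleOf τ A, G.circleOf τ B}).card +
          ((if (!h A && ell A) = true then 1 else 0) + (if (!h B && ell B) = true then 1 else 0)) := by
    intro h hh
    rw [pairCount, ← Finset.card_sdiff_add_card_inter _ {G.circleOf τ A, G.circleOf τ B}]
    congr 1
    rw [Finset.inter_comm, ← Finset.filter_mem_eq_inter, Finset.card_filter, Finset.sum_pair hAB]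
    simp only [Finset.mem_filter, Finset.mem_univ, true_and, exists_circleOf_pair_iff hh he]
  -- the remaining circles carry the same labels
  have hdiff : ((Finset.univ.filter fun C : G.StateCircle τ ↦
        ∃ x, G.circleOf τ x = C ∧
          (!(KhFace.upd (G.circleOf τ) (KhFace.upd (G.circleOf τ) f B w) A v x) && ell x) = true) \
        {G.circleOf τ A, G.circleOf τ B}) =
      ((Finset.univ.filter fun C : G.StateCircle τ ↦
        ∃ x, G.circleOf τ x = C ∧ (!f x && ell x) = true) \ {G.circleOf τ A, G.circleOf τ B}) := by
    ext C
    simp only [Finset.mem_sdiff, Finset.mem_filter, Finset.mem_univ, true_and,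
      Finset.mem_insert, Finset.mem_singleton, not_or]
    constructor
    · rintro ⟨⟨x, hx, h⟩, hCA, hCB⟩
      refine ⟨⟨x, hx, ?_⟩, hCA, hCB⟩
      have hxA : G.circleOf τ x ≠ G.circleOf τ A := fun h' ↦ hCA (hx.symm.trans h')
      have hxB : G.circleOf τ x ≠ G.circleOf τ B := fun h' ↦ hCB (hx.symm.trans h')
      rwa [KhFace.upd_of_ne hxA, KhFace.upd_of_ne hxB] at h
    · rintro ⟨⟨x, hx, h⟩, hCA, hCB⟩
      refine ⟨⟨x, hx, ?_⟩, hCA, hCB⟩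
      have hxA : G.circleOf τ x ≠ G.circleOf τ A := fun h' ↦ hCA (hx.symm.trans h')
      have hxB : G.circleOf τ x ≠ G.circleOf τ B := fun h' ↦ hCB (hx.symm.trans h')
      rwa [KhFace.upd_of_ne hxA, KhFace.upd_of_ne hxB]
  have h1 := hcount _ hgc
  have h2 := hcount f hf
  rw [hdiff, hgA, hgB] at h1
  have key : G.pairCount τ f ell + ((if (!v && ell A) = true then 1 else 0) +
      (if (!w && ell B) = true then 1 else 0)) =
      G.pairCount τ (KhFace.upd (G.circleOf τ) (KhFace.upd (G.circleOf τ) f B w) A v) ell +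
        (if (!f A && ell A) = true then 1 else 0) + (if (!f B && ell B) = true then 1 else 0) := by
    omega
  unfold pairSign
  split_ifs at key ⊢ <;> (rw [neg_one_pow_eq_of_add_eq' key]; ring)

/-! ## The tables of `ℚ[X]/(X² - 1)` in Lee's coordinates -/

/-- **Merge table**: `s(x,t) s(y,t) ∑ᵥ m(x,y;v) s(v,t) = leeSign t`, i.e. in Lee's coordinates a
merge of two circles labelled `t` has coefficient `leeSign t` (`m(𝐚,𝐚) = 2𝐚`, `m(𝐛,𝐛) = -2𝐛`,
`m(𝐚,𝐛) = 0`, read through the orthogonality `Mᵀ M = 2`). Lee (2005), §4. [cite: Lee2005, §4] -/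
theorem merge_table (x y t : Bool) :
    pairSign x t * pairSign y t * ∑ v : Bool, mergeCoeff ℚ 0 1 x y v * pairSign v t = leeSign t := by
  cases x <;> cases y <;> cases t <;> norm_num [pairSign, mergeCoeff, leeSign, Fintype.sum_bool]

/-- **Split table**: `s(x,t) ∑ᵥ ∑_w Δ(x;v,w) s(v,t) s(w,t) = 2`, i.e. in Lee's coordinates a split
of a circle labelled `t` has coefficient `2` (`Δ𝐚 = 𝐚 ⊗ 𝐚`, `Δ𝐛 = 𝐛 ⊗ 𝐛`). Lee (2005), §4. [cite: Lee2005, §4] -/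
theorem split_table (x t : Bool) :
    pairSign x t * ∑ v : Bool, ∑ w : Bool, splitCoeff ℚ 0 1 x v w * pairSign v t * pairSign w t
      = 2 := by
  cases x <;> cases t <;> norm_num [pairSign, splitCoeff, Fintype.sum_bool]

/-- **Split table, mixed labels**: against a labelling taking different values on the two new
circles the split has coefficient `0` (`Δ𝐚`, `Δ𝐛` have no `𝐚 ⊗ 𝐛` component). Lee (2005), §4.
[cite: Lee2005, §4] -/
theorem split_table_zero (x tA tB : Bool) (h : tA ≠ tB) :
    ∑ v : Bool, ∑ w : Bool, splitCoeff ℚ 0 1 x v w * pairSign v tA * pairSign w tB = 0 := by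
  cases x <;> cases tA <;> cases tB <;>
    first | exact absurd rfl h | norm_num [pairSign, splitCoeff, Fintype.sum_bool]

/-! ## The core identity: one flip -/

/-- Uniqueness of the flipped chord. [folklore] -/
theorem eq_of_update_eq_update {σ : G.State} {i j : Fin G.n} (hi : σ i = false)
    (h : Function.update σ i true = Function.update σ j true) : j = i := by
  by_contra hne
  have := congrFun h i
  rw [Function.update_self, Function.update_of_ne (Ne.symm hne), hi] at this
  exact Bool.noConfusion this

/-- A labelling of the finer state after a split is a labelling of the coarser state before it
iff it takes one value on the two new circles. [folklore] -/
theorem isLabelOf_iff_of_isSplitAt {σ : G.State} {i : Fin G.n} (hS : G.IsSplitAt σ i)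
    {ell : G.Arc → Bool} (he : G.IsLabelOf (Function.update σ i true) ell) :
    G.IsLabelOf σ ell ↔ ell (G.arcIn (G.overPos i)) = ell (G.arcOut (G.overPos i)) := by
  have S := hS.surg
  have hM : ¬ G.IsMergeAt σ i := fun hM ↦ IsMergeAt.not_isSplitAt_holds hM hS
  have heq : G.circleOf σ (G.arcIn (G.overPos i)) = G.circleOf σ (G.arcOut (G.overPos i)) := by
    by_contra hne
    exact hM ⟨hS.1, hne⟩
  constructor
  · exact fun h ↦ h.eq_of_reachable (circleOf_eq_iff.1 heq)
  · intro hAB a b hab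
    have hc := SimpleGraph.ConnectedComponent.sound hab.reachable
    change G.circleOf σ a = G.circleOf σ b at hc
    rcases (S.rel a b).1 hc with h | ⟨ha, hb⟩
    · exact he.eq_of_reachable (circleOf_eq_iff.1 h)
    · have hel : ∀ x, (G.circleOf (Function.update σ i true) x =
          G.circleOf (Function.update σ i true) (G.arcIn (G.overPos i)) ∨
          G.circleOf (Function.update σ i true) x =
          G.circleOf (Function.update σ i true) (G.arcOut (G.overPos i))) →
          ell x = ell (G.arcIn (G.overPos i)) := by
        rintro x (hx | hx)
        · exact he.eq_of_reachable (circleOf_eq_iff.1 hx)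
        · exact (he.eq_of_reachable (circleOf_eq_iff.1 hx)).trans hAB.symm
      rw [hel a ha, hel b hb]

/-- **The core identity (one flip).** Fix an enhanced state `s = (σ, λ)`, a `0`-smoothed chord
`i`, and a labelling `ℓ` of `σ' = σ[i ↦ 1]`. Then
`∑_μ (-1)^{pairCount σ' μ ℓ} ⟨d s, (σ', μ)⟩ = [ℓ ∈ Lab σ] · ε(σ,i) · leeCoef σ i ℓ · (-1)^{pairCount σ λ ℓ}`,
the sum over all labellings `μ` of `σ'`: pairing the image of `(σ, λ)` under Lee's differential
with Lee's monomial `(σ', ℓ)` gives the Lee coefficient times the pairing of `(σ, λ)` with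
`(σ, ℓ)` — this is `m(𝐚,𝐚) = 2𝐚`, `m(𝐛,𝐛) = -2𝐛`, `m(𝐚,𝐛) = 0`, `Δ𝐚 = 𝐚 ⊗ 𝐚`, `Δ𝐛 = 𝐛 ⊗ 𝐛`
(Lee (2005), §4; Rasmussen (2010), §2.1 (3)) in the enhanced-state model. [cite: Lee2005, §4] -/
theorem sum_neg_one_pow_pairCount_mul_incidence (s : G.EnhancedState) {i : Fin G.n}
    (hi : s.state i = false) {ell : G.Arc → Bool}
    (hell : G.IsLabelOf (Function.update s.state i true) ell) :
    ∑ mu : KhFace.Lab (G.circleOf (Function.update s.state i true)),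
        (-1 : ℚ) ^ G.pairCount (Function.update s.state i true) mu.1 ell *
          G.incidence ℚ 0 1 s ⟨Function.update s.state i true, mu.1, isLabelOf_of_lab mu⟩ =
      if G.IsLabelOf s.state ell then
        (edgeSign s.state i : ℚ) * G.leeCoef s.state i ell *
          (-1 : ℚ) ^ G.pairCount s.state s.label ell
      else 0 := by
  have hlam : G.IsLabelOf s.state s.label := s.isLabelOf
  have hinc : ∀ mu : KhFace.Lab (G.circleOf (Function.update s.state i true)),
      G.incidence ℚ 0 1 s ⟨Function.update s.state i true, mu.1, isLabelOf_of_lab mu⟩ =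
        (edgeSign s.state i : ℚ) *
          (if G.IsMergeAt s.state i then
            KhFace.mergeInc ℚ 0 1 (G.circleOf (Function.update s.state i true)) s.label mu.1
              (G.arcIn (G.overPos i)) (G.arcOut (G.overPos i))
          else if G.IsSplitAt s.state i then
            KhFace.splitInc ℚ 0 1 (G.circleOf s.state) s.label mu.1
              (G.arcIn (G.overPos i)) (G.arcOut (G.overPos i))
          else 0) := by
    intro mu
    rw [incidence_of_update (0 : ℚ) 1 hi rfl]
    unfold KhFace.mergeInc KhFace.splitInc
    dsimp only
    split_ifs <;> ring
  simp_rw [hinc]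
  by_cases hM : G.IsMergeAt s.state i
  · -- merge
    simp only [if_pos hM]
    have S := hM.surg
    have hell₀ : G.IsLabelOf s.state ell := fun a b hab ↦
      hell.eq_of_reachable (hM.reachable_update_of_reachable hab.reachable)
    rw [if_pos hell₀]
    unfold leeCoef
    rw [if_pos hM]
    have hswap : ∑ mu : KhFace.Lab (G.circleOf (Function.update s.state i true)),
        (-1 : ℚ) ^ G.pairCount (Function.update s.state i true) mu.1 ell *
          ((edgeSign s.state i : ℚ) *
            KhFace.mergeInc ℚ 0 1 (G.circleOf (Function.update s.state i true)) s.label mu.1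
              (G.arcIn (G.overPos i)) (G.arcOut (G.overPos i))) =
        (edgeSign s.state i : ℚ) *
          ∑ mu : KhFace.Lab (G.circleOf (Function.update s.state i true)),
            KhFace.mergeInc ℚ 0 1 (G.circleOf (Function.update s.state i true)) s.label mu.1
              (G.arcIn (G.overPos i)) (G.arcOut (G.overPos i)) *
            (-1 : ℚ) ^ G.pairCount (Function.update s.state i true) mu.1 ell := by
      rw [Finset.mul_sum]
      exact Finset.sum_congr rfl fun mu _ ↦ by ring
    have hm := KhFace.sum_mergeInc_mul (R := ℚ) (h := 0) (t := 1) S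
      ⟨s.label, lab_of_isLabelOf hlam⟩
      (fun f ↦ (-1 : ℚ) ^ G.pairCount (Function.update s.state i true) f ell)
    dsimp only at hm
    have hm' : (∑ mu : KhFace.Lab (G.circleOf (Function.update s.state i true)),
        KhFace.mergeInc ℚ 0 1 (G.circleOf (Function.update s.state i true)) s.label mu.1
          (G.arcIn (G.overPos i)) (G.arcOut (G.overPos i)) *
        (-1 : ℚ) ^ G.pairCount (Function.update s.state i true) mu.1 ell) =
        ∑ v : Bool, mergeCoeff ℚ 0 1 (s.label (G.arcIn (G.overPos i)))
          (s.label (G.arcOut (G.overPos i))) v *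
          (-1 : ℚ) ^ G.pairCount (Function.update s.state i true)
            (KhFace.upd (G.circleOf (Function.update s.state i true)) s.label
              (G.arcIn (G.overPos i)) v) ell := by
      convert hm using 2; ext; simp
    rw [hswap, hm']
    rw [Fintype.sum_bool, neg_one_pow_pairCount_merge hM hlam hell true,
      neg_one_pow_pairCount_merge hM hlam hell false]
    have heqc : G.circleOf (Function.update s.state i true) (G.arcIn (G.overPos i)) =
        G.circleOf (Function.update s.state i true) (G.arcOut (G.overPos i)) := by
      by_contra hne
      exact IsMergeAt.not_isSplitAt_holds hM ⟨hM.1, hne⟩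
    have hAB : ell (G.arcOut (G.overPos i)) = ell (G.arcIn (G.overPos i)) :=
      hell.eq_of_reachable (circleOf_eq_iff.1 heqc.symm)
    rw [hAB]
    have tab := merge_table (s.label (G.arcIn (G.overPos i))) (s.label (G.arcOut (G.overPos i)))
      (ell (G.arcIn (G.overPos i)))
    rw [Fintype.sum_bool] at tab
    linear_combination (edgeSign s.state i : ℚ) *
      (-1 : ℚ) ^ G.pairCount s.state s.label ell * tab
  · simp only [if_neg hM]
    by_cases hSp : G.IsSplitAt s.state i
    · -- split
      simp only [if_pos hSp]
      have S := hSp.surg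
      have hswap : ∑ mu : KhFace.Lab (G.circleOf (Function.update s.state i true)),
          (-1 : ℚ) ^ G.pairCount (Function.update s.state i true) mu.1 ell *
            ((edgeSign s.state i : ℚ) *
              KhFace.splitInc ℚ 0 1 (G.circleOf s.state) s.label mu.1
                (G.arcIn (G.overPos i)) (G.arcOut (G.overPos i))) =
          (edgeSign s.state i : ℚ) *
            ∑ mu : KhFace.Lab (G.circleOf (Function.update s.state i true)),
              KhFace.splitInc ℚ 0 1 (G.circleOf s.state) s.label mu.1
                (G.arcIn (G.overPos i)) (G.arcOut (G.overPos i)) *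
              (-1 : ℚ) ^ G.pairCount (Function.update s.state i true) mu.1 ell := by
        rw [Finset.mul_sum]
        exact Finset.sum_congr rfl fun mu _ ↦ by ring
      have hsp := KhFace.sum_splitInc_mul (R := ℚ) (h := 0) (t := 1) S
        ⟨s.label, lab_of_isLabelOf hlam⟩
        (fun f ↦ (-1 : ℚ) ^ G.pairCount (Function.update s.state i true) f ell)
      dsimp only at hsp
      have hsp' : (∑ mu : KhFace.Lab (G.circleOf (Function.update s.state i true)),
          KhFace.splitInc ℚ 0 1 (G.circleOf s.state) s.label mu.1
            (G.arcIn (G.overPos i)) (G.arcOut (G.overPos i)) *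
          (-1 : ℚ) ^ G.pairCount (Function.update s.state i true) mu.1 ell) =
          ∑ v : Bool, ∑ w : Bool, splitCoeff ℚ 0 1 (s.label (G.arcIn (G.overPos i))) v w *
            (-1 : ℚ) ^ G.pairCount (Function.update s.state i true)
              (KhFace.upd (G.circleOf (Function.update s.state i true))
                (KhFace.upd (G.circleOf (Function.update s.state i true)) s.label
                  (G.arcOut (G.overPos i)) w) (G.arcIn (G.overPos i)) v) ell := by
        convert hsp using 2; ext; simp
      rw [hswap, hsp']
      unfold leeCoef
      rw [if_neg hM, if_pos hSp]
      by_cases hell₀ : G.IsLabelOf s.state ell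
      · rw [if_pos hell₀]
        simp only [Fintype.sum_bool]
        rw [neg_one_pow_pairCount_split hSp hlam hell₀ true true,
          neg_one_pow_pairCount_split hSp hlam hell₀ true false,
          neg_one_pow_pairCount_split hSp hlam hell₀ false true,
          neg_one_pow_pairCount_split hSp hlam hell₀ false false]
        have hAB : ell (G.arcOut (G.overPos i)) = ell (G.arcIn (G.overPos i)) :=
          ((isLabelOf_iff_of_isSplitAt hSp hell).1 hell₀).symm
        rw [hAB]
        have tab := split_table (s.label (G.arcIn (G.overPos i))) (ell (G.arcIn (G.overPos i)))
        simp only [Fintype.sum_bool] at tab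
        linear_combination (edgeSign s.state i : ℚ) *
          (-1 : ℚ) ^ G.pairCount s.state s.label ell * tab
      · rw [if_neg hell₀]
        have hAB : ell (G.arcIn (G.overPos i)) ≠ ell (G.arcOut (G.overPos i)) :=
          fun h ↦ hell₀ ((isLabelOf_iff_of_isSplitAt hSp hell).2 h)
        have hlam' : G.IsLabelOf (Function.update s.state i true) s.label := fun a b hab ↦
          hlam.eq_of_reachable (hSp.reachable_of_reachable_update hab.reachable)
        set K : ℚ := (-1 : ℚ) ^ G.pairCount (Function.update s.state i true) s.label ell *
          pairSign (s.label (G.arcIn (G.overPos i))) (ell (G.arcIn (G.overPos i))) *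
          pairSign (s.label (G.arcOut (G.overPos i))) (ell (G.arcOut (G.overPos i))) with hKdef
        have hK : ∀ v w : Bool, (-1 : ℚ) ^ G.pairCount (Function.update s.state i true)
            (KhFace.upd (G.circleOf (Function.update s.state i true))
              (KhFace.upd (G.circleOf (Function.update s.state i true)) s.label
                (G.arcOut (G.overPos i)) w) (G.arcIn (G.overPos i)) v) ell =
            K * pairSign v (ell (G.arcIn (G.overPos i))) * pairSign w (ell (G.arcOut (G.overPos i))) := by
          intro v w
          have h := neg_one_pow_pairCount_upd_upd S.ne hlam' hell v w
          have hs1 := pairSign_mul_self (s.label (G.arcIn (G.overPos i))) (ell (G.arcIn (G.overPos i)))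
          have hs2 := pairSign_mul_self (s.label (G.arcOut (G.overPos i))) (ell (G.arcOut (G.overPos i)))
          rw [hKdef]
          linear_combination (pairSign (s.label (G.arcIn (G.overPos i))) (ell (G.arcIn (G.overPos i))) *
              pairSign (s.label (G.arcOut (G.overPos i))) (ell (G.arcOut (G.overPos i)))) * h -
            ((-1 : ℚ) ^ G.pairCount (Function.update s.state i true)
              (KhFace.upd (G.circleOf (Function.update s.state i true))
                (KhFace.upd (G.circleOf (Function.update s.state i true)) s.label
                  (G.arcOut (G.overPos i)) w) (G.arcIn (G.overPos i)) v) ell) *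
              (pairSign (s.label (G.arcOut (G.overPos i))) (ell (G.arcOut (G.overPos i))) *
                pairSign (s.label (G.arcOut (G.overPos i))) (ell (G.arcOut (G.overPos i))) * hs1 + hs2)
        simp only [Fintype.sum_bool]
        rw [hK true true, hK true false, hK false true, hK false false]
        have tab := split_table_zero (s.label (G.arcIn (G.overPos i))) (ell (G.arcIn (G.overPos i)))
          (ell (G.arcOut (G.overPos i))) hAB
        simp only [Fintype.sum_bool] at tab
        linear_combination ((edgeSign s.state i : ℚ) * K) * tab
    · -- one-to-one bifurcation: both sides vanish
      simp only [if_neg hSp, mul_zero, Finset.sum_const_zero]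
      unfold leeCoef
      rw [if_neg hM, if_neg hSp]
      split_ifs <;> simp

/-! ## The matrices and the intertwining identity -/

variable (G) in
/-- The **incidence matrix** of Lee's differential between degrees `k` and `k'`:
`Inc(s', s) = ⟨d s, s'⟩` at `(h, t) = (0, 1)`, so that `leeD k k' = Matrix.toLin' (incMat k k')`
(`khovanovD_eq_toLin'`). Viro (2004), §5.2. [cite: Viro2004, §5.2] -/
def incMat (k k' : ℤ) : Matrix (G.degStates k') (G.degStates k) ℚ :=
  Matrix.of fun s' s ↦ G.incidence ℚ 0 1 s.1 s'.1

/-- Lee's differential is `Matrix.toLin'` of the incidence matrix (by definition of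
`khovanovD`). [folklore] -/
theorem khovanovD_eq_toLin' (k k' : ℤ) : G.khovanovD ℚ 0 1 k k' = Matrix.toLin' (G.incMat k k') :=
  rfl

variable (G) in
/-- The **label-preserving Lee matrix** between degrees `k` and `k'`: the entry at
(`(σ[i ↦ 1], ℓ)`, `(σ, ℓ)`) for a `0`-smoothed chord `i` is `edgeSign σ i · leeCoef σ i ℓ`
(`±1` at a merge, `2` at a split, `0` at a one-to-one bifurcation), and all entries between
states not related by one flip, or with different labellings, vanish. This is Lee's
differential in Lee's coordinates (`leeBasisMat_transpose_mul_incMat`). Lee (2005), §4;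
Rasmussen (2010), §2.1 (3). [cite: Lee2005, §4] -/
def leeDiffMat (k k' : ℤ) : Matrix (G.degStates k') (G.degStates k) ℚ :=
  Matrix.of fun s₂ s ↦ ∑ i : Fin G.n,
    if s.1.state i = false ∧ s₂.1.state = Function.update s.1.state i true ∧
        s₂.1.label = s.1.label then
      (edgeSign s.1.state i : ℚ) * G.leeCoef s.1.state i s.1.label
    else 0

/-- The entries of `Mᵀ · N` at the row of `(τ, ℓ)`: a sum over the labellings of `τ`.
[folklore] -/
theorem transpose_mul_apply_eq_sum_lab {k k' : ℤ} (N : Matrix (G.degStates k') (G.degStates k) ℚ)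
    (s₂ : G.degStates k') (s₁ : G.degStates k) :
    ((G.leeBasisMat k')ᵀ * N) s₂ s₁ =
      ∑ mu : KhFace.Lab (G.circleOf s₂.1.state),
        (-1 : ℚ) ^ G.pairCount s₂.1.state mu.1 s₂.1.label *
          N ((G.stateFibreLabEquiv k' s₂.1.state s₂.2).symm mu).1 s₁ := by
  classical
  rw [Matrix.mul_apply]
  simp only [Matrix.transpose_apply, leeBasisMat, Matrix.of_apply]
  have hsum : ∑ s'' : G.degStates k',
      (if s''.1.state = s₂.1.state then
        (-1 : ℚ) ^ G.pairCount s₂.1.state s''.1.label s₂.1.label else 0) * N s'' s₁ =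
      ∑ s'' : {s'' : G.degStates k' // s''.1.state = s₂.1.state},
        (-1 : ℚ) ^ G.pairCount s₂.1.state s''.1.1.label s₂.1.label * N s''.1 s₁ := by
    rw [← Finset.sum_subset (Finset.filter_subset
      (fun s'' : G.degStates k' ↦ s''.1.state = s₂.1.state) Finset.univ)]
    · rw [Finset.sum_subtype (Finset.univ.filter fun s'' : G.degStates k' ↦
          s''.1.state = s₂.1.state) (p := fun s'' : G.degStates k' ↦ s''.1.state = s₂.1.state)
          (fun s'' ↦ by simp)]
      refine Fintype.sum_congr _ _ fun s'' ↦ ?_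
      rw [if_pos s''.2]
    · intro s'' _ hs''
      rw [Finset.mem_filter, not_and] at hs''
      rw [if_neg (hs'' (Finset.mem_univ _)), zero_mul]
  rw [hsum]
  exact (Fintype.sum_equiv (G.stateFibreLabEquiv k' s₂.1.state s₂.2).symm _ _ (fun _ ↦ rfl)).symm

/-- The entries of `leeDiffMat · Mᵀ` vanish between states not related by one flip. [folklore] -/
theorem leeDiffMat_mul_transpose_apply_of_not_exists {k k' : ℤ} (s₂ : G.degStates k')
    (s₁ : G.degStates k)
    (hex : ¬ ∃ i, s₁.1.state i = false ∧ s₂.1.state = Function.update s₁.1.state i true) :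
    (G.leeDiffMat k k' * (G.leeBasisMat k)ᵀ) s₂ s₁ = 0 := by
  classical
  rw [Matrix.mul_apply]
  refine Finset.sum_eq_zero fun s _ ↦ ?_
  simp only [Matrix.transpose_apply, leeBasisMat, leeDiffMat, Matrix.of_apply]
  by_cases hst : s₁.1.state = s.1.state
  · rw [Finset.sum_eq_zero, zero_mul]
    intro i _
    rw [if_neg]
    rintro ⟨hi, h2, -⟩
    exact hex ⟨i, by rw [hst]; exact hi, by rw [hst]; exact h2⟩
  · rw [if_neg hst, mul_zero]

/-- The entries of `leeDiffMat · Mᵀ` between `(σ, λ)` and `(σ[i ↦ 1], ℓ)`: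
`[ℓ ∈ Lab σ] · ε(σ,i) · leeCoef σ i ℓ · (-1)^{pairCount σ λ ℓ}`. [folklore] -/
theorem leeDiffMat_mul_transpose_apply_of_update {k k' : ℤ} (s₂ : G.degStates k')
    (s₁ : G.degStates k) {i : Fin G.n} (hi : s₁.1.state i = false)
    (hσ₂ : s₂.1.state = Function.update s₁.1.state i true) :
    (G.leeDiffMat k k' * (G.leeBasisMat k)ᵀ) s₂ s₁ =
      if G.IsLabelOf s₁.1.state s₂.1.label then
        (edgeSign s₁.1.state i : ℚ) * G.leeCoef s₁.1.state i s₂.1.label *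
          (-1 : ℚ) ^ G.pairCount s₁.1.state s₁.1.label s₂.1.label
      else 0 := by
  classical
  rw [Matrix.mul_apply]
  simp only [Matrix.transpose_apply, leeBasisMat, leeDiffMat, Matrix.of_apply]
  by_cases hℓ : G.IsLabelOf s₁.1.state s₂.1.label
  · rw [if_pos hℓ]
    let s₀ : G.degStates k := ⟨⟨s₁.1.state, s₂.1.label, hℓ⟩, s₁.2⟩
    rw [Finset.sum_eq_single s₀]
    · -- the term at `s₀`
      simp only [s₀, if_true, and_true]
      rw [Finset.sum_eq_single i]
      · rw [if_pos ⟨hi, hσ₂⟩]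
      · intro j _ hji
        rw [if_neg]
        rintro ⟨-, hj⟩
        exact hji (eq_of_update_eq_update hi (hσ₂.symm.trans hj))
      · exact fun h ↦ absurd (Finset.mem_univ i) h
    · intro s _ hs
      by_cases hst : s₁.1.state = s.1.state
      · have hlab : s₂.1.label ≠ s.1.label := by
          intro hl
          apply hs
          apply Subtype.ext
          exact EnhancedState.ext' hst.symm hl.symm
        rw [Finset.sum_eq_zero, zero_mul]
        intro j _
        rw [if_neg]
        rintro ⟨-, -, h3⟩
        exact hlab h3
      · rw [if_neg hst, mul_zero]
    · exact fun h ↦ absurd (Finset.mem_univ s₀) h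
  · rw [if_neg hℓ]
    refine Finset.sum_eq_zero fun s _ ↦ ?_
    by_cases hst : s₁.1.state = s.1.state
    · rw [Finset.sum_eq_zero, zero_mul]
      intro j _
      rw [if_neg]
      rintro ⟨-, -, h3⟩
      apply hℓ
      rw [h3, hst]
      exact s.1.isLabelOf
    · rw [if_neg hst, mul_zero]

/-- **The intertwining identity.** `Mᵀ · Inc = leeDiffMat · Mᵀ`: Lee's change of coordinates
(the transpose of the change-of-basis matrix `leeBasisMat`) conjugates the incidence matrix of
Lee's differential into the label-preserving Lee matrix. Entry by entry this is the core identity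
`sum_neg_one_pow_pairCount_mul_incidence` (one flip) or `0 = 0` (no flip). Lee (2005), §4
(the differential in the basis `𝐚`, `𝐛`); Rasmussen (2010), §2.1 (3). [cite: Lee2005, §4] -/
theorem leeBasisMat_transpose_mul_incMat (k k' : ℤ) :
    (G.leeBasisMat k')ᵀ * G.incMat k k' = G.leeDiffMat k k' * (G.leeBasisMat k)ᵀ := by
  ext s₂ s₁
  by_cases hex : ∃ i, s₁.1.state i = false ∧ s₂.1.state = Function.update s₁.1.state i true
  · obtain ⟨i, hi, hσ₂⟩ := hex
    rw [leeDiffMat_mul_transpose_apply_of_update s₂ s₁ hi hσ₂, transpose_mul_apply_eq_sum_lab]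
    have key : ∀ (τ : G.State) (ell : G.Arc → Bool) (hτe : G.IsLabelOf τ ell)
        (hk : (τ.weight : ℤ) - G.nMinus = k') (hτ : τ = Function.update s₁.1.state i true),
        ∑ mu : KhFace.Lab (G.circleOf τ), (-1 : ℚ) ^ G.pairCount τ mu.1 ell *
            G.incMat k k' ((G.stateFibreLabEquiv k' τ hk).symm mu).1 s₁ =
          if G.IsLabelOf s₁.1.state ell then
            (edgeSign s₁.1.state i : ℚ) * G.leeCoef s₁.1.state i ell *
              (-1 : ℚ) ^ G.pairCount s₁.1.state s₁.1.label ell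
          else 0 := by
      intro τ ell hτe hk hτ
      subst hτ
      exact sum_neg_one_pow_pairCount_mul_incidence s₁.1 hi hτe
    exact key _ _ (isLabelOf_of_state_eq rfl) s₂.2 hσ₂
  · rw [leeDiffMat_mul_transpose_apply_of_not_exists s₂ s₁ hex, transpose_mul_apply_eq_sum_lab]
    refine Finset.sum_eq_zero fun mu _ ↦ ?_
    have h0 : G.incidence ℚ 0 1 s₁.1 ⟨s₂.1.state, mu.1, isLabelOf_of_lab mu⟩ = 0 :=
      incidence_eq_zero_of_not_exists (0 : ℚ) 1 hex
    change _ * G.incidence ℚ 0 1 s₁.1 ⟨s₂.1.state, mu.1, isLabelOf_of_lab mu⟩ = 0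
    rw [h0, mul_zero]

/-- **Lee's differential in Lee's coordinates** (linear maps): `leeCoord ∘ d = D' ∘ leeCoord`
with `D' = Matrix.toLin' leeDiffMat` label-preserving. Lee (2005), §4. [cite: Lee2005, §4] -/
theorem leeCoord_comp_khovanovD (k k' : ℤ) :
    (G.leeCoord k').toLinearMap ∘ₗ G.khovanovD ℚ 0 1 k k' =
      Matrix.toLin' (G.leeDiffMat k k') ∘ₗ (G.leeCoord k).toLinearMap := by
  apply LinearMap.ext
  intro x
  change Matrix.toLin' (G.leeBasisMat k')ᵀ (Matrix.toLin' (G.incMat k k') x) =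
    Matrix.toLin' (G.leeDiffMat k k') (Matrix.toLin' (G.leeBasisMat k)ᵀ x)
  rw [← Matrix.toLin'_mul_apply, ← Matrix.toLin'_mul_apply, leeBasisMat_transpose_mul_incMat]

end GaussDiagram

end Literature.Topology.FourManifolds
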